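import Summits.ResolutionOfSingularities.ResolutionOfSingularities.Theorems.PurelyInseparableDim4JointTwoChartComputations
import Summits.ResolutionOfSingularities.ResolutionOfSingularities.Theorems.PurelyInseparableDim4JointForestInstance
import HarnessLib

/-!
# Purely inseparable four-folds: computations for the TWO-CHILDREN instance `z^p + x₁^p (x₂² − 1)^p x₃ + x₁^{2p} x₄` of the
# monotone joint forest, `p` odd (brick S3 (c) «joint point∘coordinate chains», part 23a, cell `res-dim4-pi`)

[OURS · counted 0] (D-0157 DOOR 2; desk WORD #66 (4)(c), #74 (g), #99 (d); frame `PIDim4.TerminationImpliesOrderReduction`,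
S3 (c); host item stmt-ResolutionOfSingularities-16155, helper). Nothing here proves resolution of singularities in
dimension ≥ 4 / characteristic `p` — NOT here, not anywhere in this programme.

`F = x₁^p (x₂² − 1)^p x₃ + x₁^{2p} x₄` over `K` of characteristic `p ≠ 2`. The closed order-`p` points of `z^p + F` form the 3-fold
`{x₁ = 0}` (`roots_inst₅`: `∂F/∂x₄ = x₁^{2p}`); in the (only) chart `x₁` of its blow-up the transform is
`G = (y₂^{2p} − 1) y₃ + y₁^p y₄` (`chartTransform_inst₅`), equimultiple exactly where `y₂ = ±1`
(`sq_eq_one_of_isEquimultiplePoint_inst₅`: `∂G/∂y₃ = y₂^{2p} − 1`): TWO surface children `{y₁ = 0, y₂ = c}`, `c = ±1`, in the SAME chart,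
SEPARATED at the coordinate `y₂` (`1 ≠ −1` as `p ≠ 2`). The child equations are
`G_c = (y₂^{2p} + (2c)^p y₂^p) y₃ + y₁^p y₄` (`translate_entry_inst₅`, `step_F_inst₅`), clean, with `V(z, y₁, y₂)` permissible, and over
each child NO point of either chart is equimultiple (`not_isEquimultiplePoint_child_inst₅`: `∂/∂y₄ = 1` on the `y₁`-chart, `∂/∂y₃ = y₂^p +
(2c)^p` on the `y₂`-chart, non-zero at `y₂ = 0` since `2c ≠ 0`). The certificate is part 23b.

AI-produced formalisation, weaker than expert review. bears_on: LADDER-RESOLUTION:D157-DOOR2 (res-dim4-pi · S3 (c) joint v2 ·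
two-children instance, computations).
-/

set_option linter.dupNamespace false -- D-0017: single-problem summit path `Summit.<S>.<S>.…` by design

noncomputable section

open MvPolynomial Finset CategoryTheory AlgebraicGeometry Opposite TopologicalSpace

namespace Summit.ResolutionOfSingularities.ResolutionOfSingularities.Theorems.PIDim4

open Literature.AlgebraicGeometry.Resolution
open Literature.AlgebraicGeometry.Resolution.Hauser2010
open Literature.AlgebraicGeometry.Resolution.AffinePointBlowup (P A γ coord Wtop ξ)

namespace Equimultiple

section Instance₅

variable {K : Type} [Field K] {p : ℕ} [hp : Fact p.Prime] [CharP K p]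

/-! ## §1 The root equation `F = x₁^p (x₂² − 1)^p x₃ + x₁^{2p} x₄` -/

omit hp [CharP K p] in
/-- `x₁^p x₂^{2p} x₃` as a monomial. [folklore] -/
theorem X_pow_mul_X_pow_mul_X_eq_monomial (a b c : Fin 4) (m n : ℕ) :
    (X a ^ m * X b ^ n * X c : MvPolynomial (Fin 4) K) =
      monomial (Finsupp.single a m + Finsupp.single b n + Finsupp.single c 1) 1 := by
  rw [X_pow_eq_monomial, X_pow_eq_monomial, X, monomial_mul, monomial_mul, mul_one, mul_one]

/-- `F` as a sum of three monomials (`(x₂² − 1)^p = x₂^{2p} − 1`). [folklore] -/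
theorem inst₅_eq_monomial_add :
    (X 0 ^ p * (X 1 ^ 2 - 1) ^ p * X 2 + X 0 ^ (2 * p) * X 3 : MvPolynomial (Fin 4) K) =
      monomial (Finsupp.single 0 p + Finsupp.single 1 (2 * p) + Finsupp.single 2 1) 1 +
        monomial (Finsupp.single 0 p + Finsupp.single 2 1) (-1) + monomial (Finsupp.single 0 (2 * p) + Finsupp.single 3 1) 1 := by
  rw [sub_pow_char, one_pow, ← pow_mul, mul_sub, mul_one, sub_mul, X_pow_mul_X_pow_mul_X_eq_monomial,
    X_pow_mul_X_eq_monomial, X_pow_mul_X_eq_monomial, map_neg]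
  abel

/-- The support of `F` lies in its three exponents. [folklore] -/
theorem mem_support_inst₅ {d : Fin 4 →₀ ℕ}
    (hd : d ∈ (X 0 ^ p * (X 1 ^ 2 - 1) ^ p * X 2 + X 0 ^ (2 * p) * X 3 : MvPolynomial (Fin 4) K).support) :
    d = Finsupp.single 0 p + Finsupp.single 1 (2 * p) + Finsupp.single 2 1 ∨ d = Finsupp.single 0 p + Finsupp.single 2 1 ∨
      d = Finsupp.single 0 (2 * p) + Finsupp.single 3 1 := by
  rw [inst₅_eq_monomial_add] at hd
  rcases Finset.mem_union.mp (Finset.mem_of_subset MvPolynomial.support_add hd) with hd' | hd'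
  · rcases Finset.mem_union.mp (Finset.mem_of_subset MvPolynomial.support_add hd') with hd'' | hd''
    · exact Or.inl (Finset.mem_singleton.mp (Finset.mem_of_subset support_monomial_subset hd''))
    · exact Or.inr (Or.inl (Finset.mem_singleton.mp (Finset.mem_of_subset support_monomial_subset hd'')))
  · exact Or.inr (Or.inr (Finset.mem_singleton.mp (Finset.mem_of_subset support_monomial_subset hd')))

omit hp [CharP K p] in
/-- The three exponents are pairwise distinct. [folklore] -/
theorem inst₅_exponents_ne (hp0 : p ≠ 0) :
    (Finsupp.single 0 p + Finsupp.single 1 (2 * p) + Finsupp.single 2 1 : Fin 4 →₀ ℕ) ≠ Finsupp.single 0 p + Finsupp.single 2 1 ∧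
      (Finsupp.single 0 p + Finsupp.single 1 (2 * p) + Finsupp.single 2 1 : Fin 4 →₀ ℕ) ≠
        Finsupp.single 0 (2 * p) + Finsupp.single 3 1 ∧
      (Finsupp.single 0 p + Finsupp.single 2 1 : Fin 4 →₀ ℕ) ≠ Finsupp.single 0 (2 * p) + Finsupp.single 3 1 := by
  refine ⟨fun h => ?_, fun h => ?_, fun h => ?_⟩
  · have := DFunLike.congr_fun h 1; simp at this; exact hp0 this
  · have := DFunLike.congr_fun h 2; simp at this
  · have := DFunLike.congr_fun h 2; simp at this

/-- The coefficient of `x₁^{2p} x₄` in `F` is `1`. [folklore] -/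
theorem coeff_inst₅_lead :
    coeff (Finsupp.single (0 : Fin 4) (2 * p) + Finsupp.single 3 1)
      (X 0 ^ p * (X 1 ^ 2 - 1) ^ p * X 2 + X 0 ^ (2 * p) * X 3 : MvPolynomial (Fin 4) K) = 1 := by
  obtain ⟨-, h13, h23⟩ := inst₅_exponents_ne hp.out.ne_zero
  rw [inst₅_eq_monomial_add, coeff_add, coeff_add, coeff_monomial, if_neg h13, coeff_monomial, if_neg h23, coeff_monomial,
    if_pos rfl, zero_add, zero_add]

/-- `F ≠ 0`. [folklore] -/
theorem inst₅_ne_zero : (X 0 ^ p * (X 1 ^ 2 - 1) ^ p * X 2 + X 0 ^ (2 * p) * X 3 : MvPolynomial (Fin 4) K) ≠ 0 := by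
  intro h
  have hc := coeff_inst₅_lead (K := K) (p := p)
  rw [h, coeff_zero] at hc
  exact zero_ne_one hc

/-- `F` is clean (each monomial has an exponent `1`). [cite: HauserPerlega2019PRIMS, §2 (cleaning)] -/
theorem isClean_inst₅ :
    Literature.Barriers.ResolutionOfSingularities.HauserPerlega.IsClean p
      (X 0 ^ p * (X 1 ^ 2 - 1) ^ p * X 2 + X 0 ^ (2 * p) * X 3 : MvPolynomial (Fin 4) K) := by
  intro d hd hpth
  rcases mem_support_inst₅ hd with rfl | rfl | rfl
  · have h0 : (Finsupp.single 0 p + Finsupp.single 1 (2 * p) + Finsupp.single 2 1 : Fin 4 →₀ ℕ) 2 = 1 := by simp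
    have h := hpth 2 (by rw [Finsupp.mem_support_iff, h0]; exact one_ne_zero)
    rw [h0] at h
    exact hp.out.one_lt.ne' (Nat.dvd_one.mp h)
  · have h0 : (Finsupp.single 0 p + Finsupp.single 2 1 : Fin 4 →₀ ℕ) 2 = 1 := by simp
    have h := hpth 2 (by rw [Finsupp.mem_support_iff, h0]; exact one_ne_zero)
    rw [h0] at h
    exact hp.out.one_lt.ne' (Nat.dvd_one.mp h)
  · have h0 : (Finsupp.single 0 (2 * p) + Finsupp.single 3 1 : Fin 4 →₀ ℕ) 3 = 1 := by simp
    have h := hpth 3 (by rw [Finsupp.mem_support_iff, h0]; exact one_ne_zero)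
    rw [h0] at h
    exact hp.out.one_lt.ne' (Nat.dvd_one.mp h)

/-- **`V(z, x₁)` is Hironaka-permissible for `z^p + F`.** [cite: HauserPerlega2019PRIMS, §2 (condition (1))] -/
theorem isPermissibleCentre_inst₅ :
    IsPermissibleCentre p ({0} : Finset (Fin 4)) (X 0 ^ p * (X 1 ^ 2 - 1) ^ p * X 2 + X 0 ^ (2 * p) * X 3 : MvPolynomial (Fin 4) K) := by
  refine ⟨⟨0, Finset.mem_singleton_self _⟩, Finset.le_inf fun d hd => ?_⟩
  rcases mem_support_inst₅ hd with rfl | rfl | rfl <;> simp [degIn_singleton_zero]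
  exact_mod_cast (by omega : p ≤ 2 * p)

/-- **The `x₁`-chart transform of `F` is `G = (y₂^{2p} − 1) y₃ + y₁^p y₄`.** [cite: HauserPerlega2019PRIMS, §2 (the x₁-chart)] -/
theorem chartTransform_inst₅ :
    CentreBlowup.chartTransform p ({0} : Finset (Fin 4)) 0
        (X 0 ^ p * (X 1 ^ 2 - 1) ^ p * X 2 + X 0 ^ (2 * p) * X 3 : MvPolynomial (Fin 4) K) =
      (X 1 ^ (2 * p) - 1) * X 2 + X 0 ^ p * X 3 := by
  rw [inst₅_eq_monomial_add, CentreBlowup.chartTransform_add, CentreBlowup.chartTransform_monomial_add_monomial,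
    CentreBlowup.chartTransform_monomial, CentreBlowup.chartExponent, CentreBlowup.chartExponent,
    CentreBlowup.chartExponent, degIn_singleton_zero, degIn_singleton_zero, degIn_singleton_zero]
  have e1 : (Finsupp.single 0 p + Finsupp.single 1 (2 * p) + Finsupp.single 2 1 : Fin 4 →₀ ℕ).update 0
      ((Finsupp.single 0 p + Finsupp.single 1 (2 * p) + Finsupp.single 2 1 : Fin 4 →₀ ℕ) 0 - p) =
        Finsupp.single 1 (2 * p) + Finsupp.single 2 1 := by
    ext i; fin_cases i <;> simp [Finsupp.update_apply]
  have e2 : (Finsupp.single 0 p + Finsupp.single 2 1 : Fin 4 →₀ ℕ).update 0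
      ((Finsupp.single 0 p + Finsupp.single 2 1 : Fin 4 →₀ ℕ) 0 - p) = Finsupp.single 2 1 := by
    ext i; fin_cases i <;> simp [Finsupp.update_apply]
  have e3 : (Finsupp.single 0 (2 * p) + Finsupp.single 3 1 : Fin 4 →₀ ℕ).update 0
      ((Finsupp.single 0 (2 * p) + Finsupp.single 3 1 : Fin 4 →₀ ℕ) 0 - p) = Finsupp.single 0 p + Finsupp.single 3 1 := by
    ext i; fin_cases i <;> simp [Finsupp.update_apply]
    omega
  rw [e1, e2, e3, map_neg, ← X_pow_mul_X_eq_monomial, ← X_pow_mul_X_eq_monomial, show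
    (monomial (Finsupp.single 2 1) (1 : K) : MvPolynomial (Fin 4) K) = X 2 from rfl]
  ring

omit [CharP K p] in
/-- **The root parameters lie on the member**: order `p` at `(a, b)` forces `b₁ = 0` (`∂F/∂x₄ = x₁^{2p}`).
[cite: Hauser2010, §F (equiconstant points)] -/
theorem roots_inst₅ (b : Fin 4 → K)
    (H : ∀ d : Fin 4 →₀ ℕ, d ≠ 0 → d.degree < p →
      coeff d (PointBlowup.translate b (X 0 ^ p * (X 1 ^ 2 - 1) ^ p * X 2 + X 0 ^ (2 * p) * X 3 : MvPolynomial (Fin 4) K)) = 0) :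
    b 0 = 0 := by
  have h3 := eval_pderiv_eq_zero_of_forall_coeff b _ H 3
  simp [(pderiv (3 : Fin 4)).leibniz_pow] at h3
  exact h3.1

/-- **In the `x₁`-chart the equimultiple points have `y₂² = 1`** (`∂G/∂y₃ = y₂^{2p} − 1 = (y₂² − 1)^p`).
[cite: Hauser2010, §F (equiconstant points)] -/
theorem sq_eq_one_of_isEquimultiplePoint_inst₅ [DecidableEq K] {b : Fin 4 → K}
    (h : CentreBlowup.IsEquimultiplePoint p ({0} : Finset (Fin 4)) 0 b
      (⟨X 0 ^ p * (X 1 ^ 2 - 1) ^ p * X 2 + X 0 ^ (2 * p) * X 3, 0, ∅⟩ : State K)) : b 1 = 1 ∨ b 1 = -1 := by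
  unfold CentreBlowup.IsEquimultiplePoint CentreBlowup.pointTransform at h
  rw [show (⟨X 0 ^ p * (X 1 ^ 2 - 1) ^ p * X 2 + X 0 ^ (2 * p) * X 3, 0, ∅⟩ : State K).F =
      X 0 ^ p * (X 1 ^ 2 - 1) ^ p * X 2 + X 0 ^ (2 * p) * X 3 from rfl, chartTransform_inst₅] at h
  have h2 := eval_pderiv_eq_zero_of_forall_coeff b _ h 2
  simp [(pderiv (2 : Fin 4)).leibniz_pow] at h2
  have h1 : (b 1 * b 1) ^ p = (1 : K) ^ p := by rw [← pow_two, ← pow_mul, one_pow]; exact sub_eq_zero.mp h2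
  exact mul_self_eq_one_iff.mp (frobenius_inj K p h1)

/-! ## §2 The children `G_c = (y₂^{2p} + (2c)^p y₂^p) y₃ + y₁^p y₄`, `c² = 1` -/

/-- **`G` translated to the entry `(0, c, 0, 0)` with `c² = 1` is `G_c`** (`(y₂ + c)^{2p} − 1 = y₂^{2p} + (2c)^p y₂^p`). [folklore] -/
theorem translate_entry_inst₅ (c : K) (hc : c * c = 1) :
    PointBlowup.translate (Function.update (0 : Fin 4 → K) 1 c) ((X 1 ^ (2 * p) - 1) * X 2 + X 0 ^ p * X 3 : MvPolynomial (Fin 4) K) =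
      (X 1 ^ (2 * p) + C ((2 * c) ^ p) * X 1 ^ p) * X 2 + X 0 ^ p * X 3 := by
  have hC : (C c : MvPolynomial (Fin 4) K) * C c = 1 := by rw [← map_mul, hc, map_one]
  have hsq : ((X 1 + C c) ^ 2 - 1 : MvPolynomial (Fin 4) K) = X 1 ^ 2 + (2 * C c) * X 1 := by
    linear_combination hC
  unfold PointBlowup.translate
  simp only [map_add, map_sub, map_mul, map_pow, map_one, aeval_X, Function.update_self,
    Function.update_of_ne (show (0 : Fin 4) ≠ 1 by decide), Function.update_of_ne (show (2 : Fin 4) ≠ 1 by decide),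
    Function.update_of_ne (show (3 : Fin 4) ≠ 1 by decide), Pi.zero_apply, map_zero, add_zero]
  rw [pow_mul, show ((X 1 + C c) ^ 2) ^ p - 1 = ((X 1 + C c) ^ 2 - 1 : MvPolynomial (Fin 4) K) ^ p by rw [sub_pow_char, one_pow],
    hsq, add_pow_char, mul_pow, ← pow_mul, map_ofNat]

omit hp [CharP K p] in
/-- `G_u = (y₂^{2p} + u·y₂^p) y₃ + y₁^p y₄` as a sum of three monomials. [folklore] -/
theorem child_inst₅_eq_monomial_add (u : K) :
    ((X 1 ^ (2 * p) + C u * X 1 ^ p) * X 2 + X 0 ^ p * X 3 : MvPolynomial (Fin 4) K) =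
      monomial (Finsupp.single 1 (2 * p) + Finsupp.single 2 1) 1 + monomial (Finsupp.single 1 p + Finsupp.single 2 1) u +
        monomial (Finsupp.single 0 p + Finsupp.single 3 1) 1 := by
  rw [add_mul, mul_assoc, X_pow_mul_X_eq_monomial, X_pow_mul_X_eq_monomial, X_pow_mul_X_eq_monomial, C_mul_monomial, mul_one]

omit hp [CharP K p] in
/-- The support of `G_u` lies in its three exponents. [folklore] -/
theorem mem_support_child_inst₅ (u : K) {d : Fin 4 →₀ ℕ}
    (hd : d ∈ ((X 1 ^ (2 * p) + C u * X 1 ^ p) * X 2 + X 0 ^ p * X 3 : MvPolynomial (Fin 4) K).support) :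
    d = Finsupp.single 1 (2 * p) + Finsupp.single 2 1 ∨ d = Finsupp.single 1 p + Finsupp.single 2 1 ∨
      d = Finsupp.single 0 p + Finsupp.single 3 1 := by
  rw [child_inst₅_eq_monomial_add] at hd
  rcases Finset.mem_union.mp (Finset.mem_of_subset MvPolynomial.support_add hd) with hd' | hd'
  · rcases Finset.mem_union.mp (Finset.mem_of_subset MvPolynomial.support_add hd') with hd'' | hd''
    · exact Or.inl (Finset.mem_singleton.mp (Finset.mem_of_subset support_monomial_subset hd''))
    · exact Or.inr (Or.inl (Finset.mem_singleton.mp (Finset.mem_of_subset support_monomial_subset hd'')))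
  · exact Or.inr (Or.inr (Finset.mem_singleton.mp (Finset.mem_of_subset support_monomial_subset hd')))

omit [CharP K p] in
/-- `G_u` is clean. [cite: HauserPerlega2019PRIMS, §2 (cleaning)] -/
theorem isClean_child_inst₅ (u : K) :
    Literature.Barriers.ResolutionOfSingularities.HauserPerlega.IsClean p
      ((X 1 ^ (2 * p) + C u * X 1 ^ p) * X 2 + X 0 ^ p * X 3 : MvPolynomial (Fin 4) K) := by
  intro d hd hpth
  rcases mem_support_child_inst₅ u hd with rfl | rfl | rfl
  · have h0 : (Finsupp.single 1 (2 * p) + Finsupp.single 2 1 : Fin 4 →₀ ℕ) 2 = 1 := by simp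
    have h := hpth 2 (by rw [Finsupp.mem_support_iff, h0]; exact one_ne_zero)
    rw [h0] at h
    exact hp.out.one_lt.ne' (Nat.dvd_one.mp h)
  · have h0 : (Finsupp.single 1 p + Finsupp.single 2 1 : Fin 4 →₀ ℕ) 2 = 1 := by simp
    have h := hpth 2 (by rw [Finsupp.mem_support_iff, h0]; exact one_ne_zero)
    rw [h0] at h
    exact hp.out.one_lt.ne' (Nat.dvd_one.mp h)
  · have h0 : (Finsupp.single 0 p + Finsupp.single 3 1 : Fin 4 →₀ ℕ) 3 = 1 := by simp
    have h := hpth 3 (by rw [Finsupp.mem_support_iff, h0]; exact one_ne_zero)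
    rw [h0] at h
    exact hp.out.one_lt.ne' (Nat.dvd_one.mp h)

omit hp [CharP K p] in
/-- **`V(z, y₁, y₂)` is Hironaka-permissible for `z^p + G_u`.** [cite: HauserPerlega2019PRIMS, §2 (condition (1))] -/
theorem isPermissibleCentre_child_inst₅ (u : K) :
    IsPermissibleCentre p ({0, 1} : Finset (Fin 4)) ((X 1 ^ (2 * p) + C u * X 1 ^ p) * X 2 + X 0 ^ p * X 3 : MvPolynomial (Fin 4) K) := by
  refine ⟨⟨0, Finset.mem_insert_self _ _⟩, Finset.le_inf fun d hd => ?_⟩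
  rcases mem_support_child_inst₅ u hd with rfl | rfl | rfl <;> simp [degIn_pair]
  exact_mod_cast (by omega : p ≤ 2 * p)

/-- **The `F`-component of the child state** `step p {x₁} x₁ (0,c,0,0) (F, 0, ∅)` is `G_c` (`c² = 1`).
[cite: Hauser2010, §§F–G] [cite: HauserPerlega2019PRIMS, §2] -/
theorem step_F_inst₅ [DecidableEq K] (c : K) (hc : c * c = 1) :
    (CentreBlowup.step p ({0} : Finset (Fin 4)) 0 (Function.update (0 : Fin 4 → K) 1 c)
        (⟨X 0 ^ p * (X 1 ^ 2 - 1) ^ p * X 2 + X 0 ^ (2 * p) * X 3, 0, ∅⟩ : State K)).F =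
      (X 1 ^ (2 * p) + C ((2 * c) ^ p) * X 1 ^ p) * X 2 + X 0 ^ p * X 3 := by
  show deletePthPowers p (PointBlowup.translate (Function.update (0 : Fin 4 → K) 1 c)
    (CentreBlowup.chartTransform p ({0} : Finset (Fin 4)) 0
      (X 0 ^ p * (X 1 ^ 2 - 1) ^ p * X 2 + X 0 ^ (2 * p) * X 3 : MvPolynomial (Fin 4) K))) = _
  rw [chartTransform_inst₅, translate_entry_inst₅ c hc]
  exact Literature.Barriers.ResolutionOfSingularities.HauserPerlega.deletePthPowers_eq_self (isClean_child_inst₅ _)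

/-- **The entries `(x₁, (0,c,0,0))`, `c² = 1`, are equimultiple pairs** (`G_c` has no monomial of degree `< p`).
[cite: Hauser2010, §F (equiconstant points)] -/
theorem isEquimultiplePoint_inst₅_entry [DecidableEq K] (c : K) (hc : c * c = 1) :
    CentreBlowup.IsEquimultiplePoint p ({0} : Finset (Fin 4)) 0 (Function.update (0 : Fin 4 → K) 1 c)
      (⟨X 0 ^ p * (X 1 ^ 2 - 1) ^ p * X 2 + X 0 ^ (2 * p) * X 3, 0, ∅⟩ : State K) := by
  intro d hd hdp
  unfold CentreBlowup.pointTransform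
  rw [show (⟨X 0 ^ p * (X 1 ^ 2 - 1) ^ p * X 2 + X 0 ^ (2 * p) * X 3, 0, ∅⟩ : State K).F =
      X 0 ^ p * (X 1 ^ 2 - 1) ^ p * X 2 + X 0 ^ (2 * p) * X 3 from rfl, chartTransform_inst₅, translate_entry_inst₅ c hc]
  by_contra hne
  rcases mem_support_child_inst₅ _ (MvPolynomial.mem_support_iff.mpr hne) with rfl | rfl | rfl
  · rw [map_add, Finsupp.degree_single, Finsupp.degree_single] at hdp
    omega
  · rw [map_add, Finsupp.degree_single, Finsupp.degree_single] at hdp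
    omega
  · rw [map_add, Finsupp.degree_single, Finsupp.degree_single] at hdp
    omega

omit [CharP K p] in
/-- **Over a child, NO point of either chart is equimultiple** when `u ≠ 0`: on the `y₁`-chart the transform of `G_u` has the linear
monomial `y₄` (`∂/∂y₄ = 1`), on the `y₂`-chart `∂/∂y₃ = y₂^p + u`, which is `u ≠ 0` at `y₂ = 0`. [cite: Hauser2010, §F (equiconstant points)] -/
theorem not_isEquimultiplePoint_child_inst₅ [DecidableEq K] (u : K) (hu : u ≠ 0) {j : Fin 4} (hj : j ∈ ({0, 1} : Finset (Fin 4)))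
    (b : Fin 4 → K) (hbj : b j = 0) :
    ¬ CentreBlowup.IsEquimultiplePoint p ({0, 1} : Finset (Fin 4)) j b
      (⟨(X 1 ^ (2 * p) + C u * X 1 ^ p) * X 2 + X 0 ^ p * X 3, 0, ∅⟩ : State K) := by
  intro h
  unfold CentreBlowup.IsEquimultiplePoint CentreBlowup.pointTransform at h
  rw [show (⟨(X 1 ^ (2 * p) + C u * X 1 ^ p) * X 2 + X 0 ^ p * X 3, 0, ∅⟩ : State K).F =
      (X 1 ^ (2 * p) + C u * X 1 ^ p) * X 2 + X 0 ^ p * X 3 from rfl, child_inst₅_eq_monomial_add,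
    CentreBlowup.chartTransform_add, CentreBlowup.chartTransform_monomial_add_monomial, CentreBlowup.chartTransform_monomial,
    CentreBlowup.chartExponent, CentreBlowup.chartExponent, CentreBlowup.chartExponent, degIn_pair, degIn_pair, degIn_pair] at h
  rcases Finset.mem_insert.mp hj with rfl | hj
  · -- `y₁`-chart: the monomial `y₁^p y₄` becomes `y₄`
    have e3 : (Finsupp.single 0 p + Finsupp.single 3 1 : Fin 4 →₀ ℕ).update 0
        ((Finsupp.single 0 p + Finsupp.single 3 1 : Fin 4 →₀ ℕ) 0 +
          (Finsupp.single 0 p + Finsupp.single 3 1 : Fin 4 →₀ ℕ) 1 - p) = Finsupp.single 3 1 := by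
      ext i; fin_cases i <;> simp [Finsupp.update_apply]
    rw [e3] at h
    have h3 := eval_pderiv_eq_zero_of_forall_coeff b _ h 3
    simp [pderiv_monomial] at h3
  · -- `y₂`-chart: `∂/∂y₃ = y₂^p + u`
    rw [Finset.mem_singleton] at hj
    subst hj
    have e1 : (Finsupp.single 1 (2 * p) + Finsupp.single 2 1 : Fin 4 →₀ ℕ).update 1
        ((Finsupp.single 1 (2 * p) + Finsupp.single 2 1 : Fin 4 →₀ ℕ) 0 +
          (Finsupp.single 1 (2 * p) + Finsupp.single 2 1 : Fin 4 →₀ ℕ) 1 - p) = Finsupp.single 1 p + Finsupp.single 2 1 := by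
      ext i; fin_cases i <;> simp [Finsupp.update_apply]
      omega
    have e2 : (Finsupp.single 1 p + Finsupp.single 2 1 : Fin 4 →₀ ℕ).update 1
        ((Finsupp.single 1 p + Finsupp.single 2 1 : Fin 4 →₀ ℕ) 0 +
          (Finsupp.single 1 p + Finsupp.single 2 1 : Fin 4 →₀ ℕ) 1 - p) = Finsupp.single 2 1 := by
      ext i; fin_cases i <;> simp [Finsupp.update_apply]
    have e3 : (Finsupp.single 0 p + Finsupp.single 3 1 : Fin 4 →₀ ℕ).update 1
        ((Finsupp.single 0 p + Finsupp.single 3 1 : Fin 4 →₀ ℕ) 0 +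
          (Finsupp.single 0 p + Finsupp.single 3 1 : Fin 4 →₀ ℕ) 1 - p) = Finsupp.single 0 p + Finsupp.single 3 1 := by
      ext i; fin_cases i <;> simp [Finsupp.update_apply]
    rw [e1, e2, e3, ← X_pow_mul_X_eq_monomial, ← X_pow_mul_X_eq_monomial, show
      (monomial (Finsupp.single 2 1) u : MvPolynomial (Fin 4) K) = C u * X 2 by rw [X, C_mul_monomial, mul_one]] at h
    have h2 := eval_pderiv_eq_zero_of_forall_coeff b _ h 2
    simp [(pderiv (2 : Fin 4)).leibniz_pow, hbj, hp.out.ne_zero] at h2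
    exact hu h2

end Instance₅

end Equimultiple

end Summit.ResolutionOfSingularities.ResolutionOfSingularities.Theorems.PIDim4

end
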